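import Mathlib
import HarnessLib
import Literature.Analysis.FluidPDE.KNSSSwirlSupNonpos
import Summits.NavierStokesRegularity.NavierStokesRegularity.Theorems.HalfSpaceWindowDoorCirculationCarryingRigiditySourcedSwirlLiouville
import Summits.NavierStokesRegularity.NavierStokesRegularity.Theorems.HalfSpaceWindowDoorCirculationCarryingRigiditySubSwirlPlateau
import Summits.NavierStokesRegularity.NavierStokesRegularity.Theorems.HalfSpaceWindowDoorCirculationCarryingRigiditySubSwirlIdentity
import Summits.NavierStokesRegularity.NavierStokesRegularity.Theorems.HalfSpaceWindowDoorCirculationCarryingRigiditySubSwirlEstimates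
import Summits.NavierStokesRegularity.NavierStokesRegularity.Theorems.HalfSpaceWindowDoorCirculationCarryingRigiditySubSwirlSourceEstimate

/-!
# Route `HalfSpaceWindowDoor`, crux `CirculationCarryingRigidity` (stmt-NavierStokesRegularity-25311) — the ONE-SIDED
# eddy-torque engine, part 5: the swirl SUBSOLUTION Liouville theorem `f ≤ 0`

Line `eddy_torque` (LEAD ns-hsw-p1 g5).  THEOREM (`nonpos`, unconditional): a swirl subsolution pair on `ℝ³ × (−∞, 0)`
(`…Defs.IsSubSwirl`: bounded, axisymmetric, smooth, radially non-decreasing `f` vanishing on the axis with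
`∂ₜf ≤ Δf − Df[u] − (2/r)∂ᵣf + A·min(1/r, 1/√(−t))·∂ᵣf` off the axis, `r‖u‖ ≤ C_u`, `div u = 0`, plus joint smoothness and
the scale-invariant gradient bound) satisfies `f ≤ 0`; with `f ≥ 0` it vanishes (`eq_zero_of_nonneg`).  This is KNSS 2009 Thm 5.3
(proof, arXiv p. 10) for SUBSOLUTIONS with a one-sided source: g3's `…SourcedSwirlLiouville.nonpos` with (i) the plateau from
positivity propagation (`…SubSwirlPlateau.exists_rescale_ge`, box end `N + 1`, plateau on `(1, N)`) instead of Lemma 2.1, and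
(ii) the tested space–time INEQUALITY (`…SubSwirlIdentity.spaceTime_inequality`) instead of the identity — the source enters with
a sign and is `O(A C_f N^{3/2})` (`…SubSwirlSourceEstimate.estimate_IV`) against the axis term `≍ M N²`.

Seat ns-hsw-p1 g5 (LEAD of 25311, cell pub-ns-dss).  WHAT THIS IS NOT: not a statement about Navier–Stokes regularity (Clay A): a
linear parabolic Liouville theorem; the crux, its stub and NS regularity remain OPEN; helper `--supports` 25311.
-/

noncomputable section

-- the summit and its single sub-problem share the name (CONVENTIONS §1), as in every Theorems file
set_option linter.dupNamespace false

namespace Summit.NavierStokesRegularity.NavierStokesRegularity.Theorems.HalfSpaceWindowDoorCirculationCarryingRigiditySubSwirlLiouville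

open MeasureTheory Set Function Filter Topology TopologicalSpace InnerProductSpace WithLp Metric
open scoped Laplacian RealInnerProductSpace ContDiff
open Literature.Analysis Literature.Analysis.FluidPDE
open Summit.NavierStokesRegularity.NavierStokesRegularity.Theorems.HalfSpaceWindowDoorCirculationCarryingRigidityDefs
open Summit.NavierStokesRegularity.NavierStokesRegularity.Theorems.HalfSpaceWindowDoorCirculationCarryingRigiditySubSwirl
open Summit.NavierStokesRegularity.NavierStokesRegularity.Theorems.HalfSpaceWindowDoorCirculationCarryingRigiditySubSwirl.IsSubSwirl
open Summit.NavierStokesRegularity.NavierStokesRegularity.Theorems.HalfSpaceWindowDoorCirculationCarryingRigiditySubSwirlSupersolution.IsSubSwirl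
  (time_lt_iff)
open Summit.NavierStokesRegularity.NavierStokesRegularity.Theorems.HalfSpaceWindowDoorCirculationCarryingRigiditySubSwirlPlateau.IsSubSwirl
open Summit.NavierStokesRegularity.NavierStokesRegularity.Theorems.HalfSpaceWindowDoorCirculationCarryingRigiditySubSwirlIdentity.IsSubSwirl
open Summit.NavierStokesRegularity.NavierStokesRegularity.Theorems.HalfSpaceWindowDoorCirculationCarryingRigiditySubSwirlEstimates.IsSubSwirl
open Summit.NavierStokesRegularity.NavierStokesRegularity.Theorems.HalfSpaceWindowDoorCirculationCarryingRigiditySubSwirlSourceEstimate.IsSubSwirl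
open Summit.NavierStokesRegularity.NavierStokesRegularity.Theorems.HalfSpaceWindowDoorCirculationCarryingRigiditySourcedSwirlLiouville.IsSourcedSwirl
  (integral_inv_sqrt_le)

namespace IsSubSwirl

/-! ### The swirl subsolution Liouville theorem: `f ≤ 0` -/

variable {Cf Cu Cg A : ℝ} {f : ℝ → (EuclideanSpace ℝ (Fin 3)) → ℝ}
  {u : ℝ → (EuclideanSpace ℝ (Fin 3)) → (EuclideanSpace ℝ (Fin 3))}

/-- **The swirl SUBSOLUTION Liouville theorem** (KNSS 2009, proof of Thm 5.3, for subsolutions with a one-sided source):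
a swirl subsolution pair on `ℝ³ × (−∞, 0)` satisfies `f ≤ 0`.  Proof = g3's `…SourcedSwirlLiouville.nonpos`: if `M = sup f > 0`, the
plateau (`exists_rescale_ge`, positivity propagation) and the tested INEQUALITY (`spaceTime_inequality`) with `L = T = N` give
`0 ≤ I₁ + ∫(A₂ + A₃ + A₄)` where the axis term is `≤ −c M N²`, the KNSS terms are `O(N) + O(ε N²)` and the one-sided source term is
`≤ O(A C_f N^{3/2})` (`estimate_IV`, `integral_inv_sqrt_le`) — impossible for `N` large and `ε` small. -/
theorem nonpos (hP : IsSubSwirl Cf Cu Cg A 0 f u) : ∀ t < 0, ∀ x, f t x ≤ 0 := by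
  intro t ht x
  by_contra hxt
  have hpos : 0 < f t x := lt_of_not_ge hxt
  obtain ⟨M, hM, -, hfM, happr⟩ := exists_sup hP ht hpos
  have hCf0 : 0 ≤ Cf := Cf_nonneg hP
  have hCu0 : 0 ≤ Cu := Cu_nonneg hP
  have hA0 : 0 ≤ A := hP.A_nonneg
  have hC := smoothTransitionC2Bound_nonneg
  have hc₂ := radialConst₂_pos
  have hv₁ : 0 ≤ volume.real (closedBall (0 : EuclideanSpace ℝ (Fin 2)) 1) := measureReal_nonneg
  have hv₂ : 0 ≤ volume.real (closedBall (0 : EuclideanSpace ℝ (Fin 2)) 2) := measureReal_nonneg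
  have hv₄ : 0 ≤ volume.real (closedBall (0 : EuclideanSpace ℝ (Fin 2)) 4) := measureReal_nonneg
  -- the `N`-independent constants and the choice of `N = L = T`
  obtain ⟨a₂, ha₂⟩ : ∃ a₂ : ℝ, a₂ = (Cf + M) * (4 * smoothTransitionC2Bound * radialConst₂ *
      (Cu + (smoothTransitionC2Bound + 1))) := ⟨_, rfl⟩
  obtain ⟨b, hb⟩ : ∃ b : ℝ, b = 32 * smoothTransitionC2Bound * (Cf + M) *
      volume.real (closedBall (0 : EuclideanSpace ℝ (Fin 2)) 1) + 1 := ⟨_, rfl⟩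
  obtain ⟨c, hc⟩ : ∃ c : ℝ, c = 64 * A * Cf * smoothTransitionC2Bound *
      volume.real (closedBall (0 : EuclideanSpace ℝ (Fin 2)) 4) := ⟨_, rfl⟩
  have ha₂0 : 0 ≤ a₂ := by rw [ha₂]; positivity
  have hb1 : 1 ≤ b := by
    have : 0 ≤ 32 * smoothTransitionC2Bound * (Cf + M) *
        volume.real (closedBall (0 : EuclideanSpace ℝ (Fin 2)) 1) := by positivity
    linarith only [this, hb]
  have hc0 : 0 ≤ c := by rw [hc]; positivity
  obtain ⟨m, hm⟩ : ∃ m : ℝ, m = 2 * M * radialConst₂ := ⟨_, rfl⟩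
  have hm0 : 0 < m := by rw [hm]; positivity
  obtain ⟨n, hn⟩ := exists_nat_ge (max (max 4 (2 * (a₂ + b) / m + 2)) ((2 * c / m + 1) ^ 2))
  obtain ⟨N, hN⟩ : ∃ N : ℝ, N = n := ⟨_, rfl⟩
  rw [← hN] at hn
  have hN4 : 4 ≤ N := ((le_max_left _ _).trans (le_max_left _ _)).trans hn
  have hN0 : (0 : ℝ) ≤ N := by linarith only [hN4]
  have hN1 : (1 : ℝ) ≤ N := by linarith only [hN4]
  have hN3 : (3 : ℝ) ≤ N := by linarith only [hN4]
  -- `m (N − 1) ≥ a₂ + b + c √N`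
  have hNab : 2 * (a₂ + b) ≤ m * (N - 1) := by
    have h := ((le_max_right _ _).trans (le_max_left _ _)).trans hn
    have h' : 2 * (a₂ + b) / m ≤ N - 2 := by linarith only [h]
    rw [div_le_iff₀ hm0] at h'
    nlinarith only [h', hm0]
  have hsqN : 2 * c / m + 1 ≤ Real.sqrt N := by
    have h := (le_max_right _ _).trans hn
    have h0 : 0 ≤ 2 * c / m + 1 := by positivity
    calc 2 * c / m + 1 = Real.sqrt ((2 * c / m + 1) ^ 2) := (Real.sqrt_sq h0).symm
      _ ≤ Real.sqrt N := Real.sqrt_le_sqrt h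
  have hsqN0 : 0 ≤ Real.sqrt N := Real.sqrt_nonneg N
  have hNc : 2 * (c * Real.sqrt N) ≤ m * (N - 1) := by
    -- `N − 1 = (√N − 1)(√N + 1) ≥ (2c/m)(√N + 1) ≥ (2c/m) √N`
    have hNsq : Real.sqrt N * Real.sqrt N = N := Real.mul_self_sqrt hN0
    have h1 : 2 * c / m ≤ Real.sqrt N - 1 := by linarith only [hsqN]
    have h2 : 2 * c / m * Real.sqrt N ≤ (Real.sqrt N - 1) * (Real.sqrt N + 1) := by
      have := mul_le_mul_of_nonneg_right h1 (by positivity : (0 : ℝ) ≤ Real.sqrt N + 1)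
      have h3 : 2 * c / m * Real.sqrt N ≤ 2 * c / m * (Real.sqrt N + 1) :=
        mul_le_mul_of_nonneg_left (by linarith only [hsqN0]) (by positivity)
      linarith only [this, h3]
    have h4 : (Real.sqrt N - 1) * (Real.sqrt N + 1) = N - 1 := by nlinarith only [hNsq]
    rw [h4, div_mul_eq_mul_div, div_le_iff₀ hm0] at h2
    linarith only [h2]
  obtain ⟨Bφ, hB⟩ := exists_bound_fderiv_laplacian_phiCut N N
  have hB0 : 0 ≤ Bφ := (norm_nonneg _).trans (hB 0 0).1
  obtain ⟨K₄, hK₄⟩ : ∃ K₄ : ℝ, K₄ = Bφ * (Cu + 1) *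
      (2 * N * volume.real (closedBall (0 : EuclideanSpace ℝ (Fin 2)) 2)) := ⟨_, rfl⟩
  have hK₄0 : 0 ≤ K₄ := by rw [hK₄]; positivity
  obtain ⟨D, hD⟩ : ∃ D : ℝ, D = 8 * smoothTransitionC2Bound * N *
      volume.real (closedBall (0 : EuclideanSpace ℝ (Fin 2)) 2) + N * K₄ := ⟨_, rfl⟩
  have hD0 : 0 ≤ D := by rw [hD]; positivity
  obtain ⟨ε, hε⟩ : ∃ ε : ℝ, ε = min (M / 2) (1 / (2 * (D + 1))) := ⟨_, rfl⟩
  have hε0 : 0 < ε := by rw [hε]; exact lt_min (by positivity) (by positivity)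
  have hεM : ε ≤ M / 2 := by rw [hε]; exact min_le_left _ _
  have hεD : ε * D ≤ 1 / 2 := by
    have hεle : ε ≤ 1 / (2 * (D + 1)) := by rw [hε]; exact min_le_right _ _
    calc ε * D ≤ 1 / (2 * (D + 1)) * D := mul_le_mul_of_nonneg_right hεle hD0
      _ ≤ 1 / 2 := by
          rw [div_mul_eq_mul_div, one_mul, div_le_iff₀ (by positivity)]; linarith only [hD0]
  have hMε : 0 ≤ M - ε := by linarith only [hεM, hM]
  -- the plateau
  obtain ⟨lam, hlam, tstar, htstar, zbar, hge⟩ :=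
    exists_rescale_ge hP hM hfM happr (L := N) (T := N) (ε := ε) hN1 hε0
  have hresc' := rescale hP hlam tstar zbar (N + 1)
  set F : ℝ → (EuclideanSpace ℝ (Fin 3)) → ℝ := stPull (lam ^ 2) lam (tstar - lam ^ 2 * (N + 1)) (zbar • eZ) f with hFdef
  set V : ℝ → (EuclideanSpace ℝ (Fin 3)) → (EuclideanSpace ℝ (Fin 3)) :=
    lam • stPull (lam ^ 2) lam (tstar - lam ^ 2 * (N + 1)) (zbar • eZ) u with hVdef
  obtain ⟨τ', hτ'def⟩ : ∃ τ' : ℝ, τ' = N + 1 + (0 - tstar) / lam ^ 2 := ⟨_, rfl⟩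
  rw [← hτ'def] at hresc'
  have hresc : IsSubSwirl Cf Cu Cg A τ' F V := hresc'
  have hτ' : N < τ' := by
    have : 0 < (0 - tstar) / lam ^ 2 := div_pos (by linarith only [htstar]) (by positivity)
    rw [hτ'def]; linarith only [this]
  have hFM : ∀ s < τ', ∀ y, F s y ≤ M := by
    intro s hs y
    rw [hFdef, stPull_rescale_apply]
    rw [hτ'def] at hs
    exact hfM _ ((time_lt_iff hlam).2 hs) _
  -- the space–time inequality and the four estimates, integrated in time
  obtain ⟨hi1, hi2, hi3, hi5, hsum⟩ := spaceTime_inequality hresc (L := N) hN0 hτ' M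
  obtain ⟨K₁, hK₁⟩ : ∃ K₁ : ℝ, K₁ = 2 * N * ((Cf + M) *
      volume.real (closedBall (0 : EuclideanSpace ℝ (Fin 2)) 1) +
        ε * volume.real (closedBall (0 : EuclideanSpace ℝ (Fin 2)) 2)) := ⟨_, rfl⟩
  obtain ⟨K₃, hK₃⟩ : ∃ K₃ : ℝ, K₃ = (M - ε) * (4 * radialConst₂ * (N - 1)) := ⟨_, rfl⟩
  obtain ⟨K₅, hK₅⟩ : ∃ K₅ : ℝ, K₅ = Cf * smoothTransitionC2Bound * volume.real (solidCylinder 4 (2 * (N + 1))) :=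
    ⟨_, rfl⟩
  have hK₁0 : 0 ≤ K₁ := by rw [hK₁]; positivity
  have hK₅0 : 0 ≤ K₅ := by rw [hK₅]; exact mul_nonneg (by positivity) measureReal_nonneg
  have hK₅val : K₅ = Cf * smoothTransitionC2Bound * (4 * (N + 1) *
      volume.real (closedBall (0 : EuclideanSpace ℝ (Fin 2)) 4)) := by
    rw [hK₅, volume_real_solidCylinder 4 (by positivity : (0 : ℝ) ≤ 2 * (N + 1))]; ring
  have hA1 : (∫ s in Ioc 0 N, ∫ y, (F s y - M) * (psiCut N y * deriv (zetaCut N) s)) ≤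
      ∫ s in Ioc 0 N, |deriv (zetaCut N) s| * K₁ := by
    refine integral_mono_ae hi1 ?_ ?_
    · exact ((continuous_deriv_zetaCut N).abs.mul continuous_const).integrableOn_Ioc
    · refine (ae_restrict_iff' measurableSet_Ioc).2 (Eventually.of_forall fun s hs => ?_)
      rw [hK₁]
      exact (le_abs_self _).trans (estimate_I hresc hN0 hτ' hε0.le hFM hge hs)
  obtain ⟨hwint, hwle⟩ := integral_inv_sqrt_le hN0 hτ'
  have hA234 : (∫ s in Ioc 0 N, ((∫ y, (F s y - M) *
        (fderiv ℝ (phiCut N N s) y (V s y) + (Δ (phiCut N N s)) y)) +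
        (∫ y, 2 / cylRadius y * (F s y * fderiv ℝ (phiCut N N s) y (eR y))) +
        ∫ y, A / Real.sqrt (τ' - s) * fderiv ℝ (F s) y (eR y) * phiCut N N s y)) ≤
      ∫ s in Ioc 0 N, ((a₂ - K₃) * zetaCut N s + ε * K₄ + A * K₅ * (Real.sqrt (τ' - s))⁻¹) := by
    refine integral_mono_ae ((hi2.add hi3).add hi5) ?_ ?_
    · exact ((continuous_const.mul (continuous_zetaCut N)).add continuous_const).integrableOn_Ioc.add
        (hwint.const_mul _)
    · refine (ae_restrict_iff' measurableSet_Ioc).2 (Eventually.of_forall fun s hs => ?_)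
      have e2 := estimate_II hresc hN1 hτ' hε0.le hFM hge hB hs
      have e3 := estimate_III hresc hN1 hτ' hMε hge hs
      have e4 := estimate_IV hresc (L := N) hτ' hs
      rw [← ha₂, ← hK₄] at e2
      rw [← hK₃] at e3
      rw [← hK₅] at e4
      have e2' := le_abs_self (∫ y, (F s y - M) *
        (fderiv ℝ (phiCut N N s) y (V s y) + (Δ (phiCut N N s)) y))
      have e4' := le_abs_self (∫ y, A / Real.sqrt (τ' - s) * fderiv ℝ (F s) y (eR y) * phiCut N N s y)
      have e4'' : A / Real.sqrt (τ' - s) * K₅ = A * K₅ * (Real.sqrt (τ' - s))⁻¹ := by ring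
      linarith only [e2, e3, e2', e4, e4', e4'']
  have hIζ' := integral_abs_deriv_zetaCut_le N
  have hIζ := sub_three_le_integral_zetaCut hN3
  have hR1 : (∫ s in Ioc 0 N, |deriv (zetaCut N) s| * K₁) =
      (∫ s in Ioc 0 N, |deriv (zetaCut N) s|) * K₁ := integral_mul_const K₁ _
  have hR2 : (∫ s in Ioc 0 N, ((a₂ - K₃) * zetaCut N s + ε * K₄ + A * K₅ * (Real.sqrt (τ' - s))⁻¹)) =
      (a₂ - K₃) * (∫ s in Ioc 0 N, zetaCut N s) + N * (ε * K₄) +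
        A * K₅ * ∫ s in Ioc 0 N, (Real.sqrt (τ' - s))⁻¹ := by
    rw [integral_add, integral_add, integral_const_mul, integral_Ioc_const hN0, integral_const_mul]
    · exact (continuous_const.mul (continuous_zetaCut N)).integrableOn_Ioc
    · exact continuous_const.integrableOn_Ioc
    · exact (continuous_const.mul (continuous_zetaCut N)).integrableOn_Ioc.add continuous_const.integrableOn_Ioc
    · exact hwint.const_mul _
  -- the source contribution: `A K₅ ∫ (τ'−s)^{-1/2} ≤ A K₅ 2√N = (c/8) (N+1) √N ≤ (c/4) N √N`
  have hE : A * K₅ * ∫ s in Ioc 0 N, (Real.sqrt (τ' - s))⁻¹ ≤ c * √N / 4 * N := by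
    have h1 : A * K₅ * ∫ s in Ioc 0 N, (Real.sqrt (τ' - s))⁻¹ ≤ A * K₅ * (2 * Real.sqrt N) :=
      mul_le_mul_of_nonneg_left hwle (by positivity)
    have h2 : A * K₅ * (2 * Real.sqrt N) = c / 8 * (N + 1) * Real.sqrt N := by
      rw [hK₅val, hc]; ring
    have h3 : c / 8 * (N + 1) * Real.sqrt N ≤ c * Real.sqrt N / 4 * N := by
      have : (N + 1) ≤ 2 * N := by linarith only [hN1]
      nlinarith only [this, hc0, hsqN0, mul_nonneg hc0 hsqN0]
    linarith only [h1, h2, h3]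
  -- the sign of `a₂ − K₃` and the elementary inequalities
  have hK₃ge : a₂ + b + c * Real.sqrt N ≤ K₃ := by
    have h1 : m * (N - 1) ≤ K₃ := by
      rw [hK₃, hm]
      nlinarith only [mul_nonneg (mul_nonneg hc₂.le (show (0 : ℝ) ≤ N - 1 by linarith only [hN4]))
        (show (0 : ℝ) ≤ M - 2 * ε by linarith only [hεM])]
    linarith only [h1, hNab, hNc]
  have hfin1 : (∫ s in Ioc 0 N, |deriv (zetaCut N) s|) * K₁ ≤ 4 * smoothTransitionC2Bound * K₁ :=
    mul_le_mul_of_nonneg_right hIζ' hK₁0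
  have hCK₁ : smoothTransitionC2Bound * K₁ = smoothTransitionC2Bound * (2 * N * ((Cf + M) *
      volume.real (closedBall (0 : EuclideanSpace ℝ (Fin 2)) 1) +
        ε * volume.real (closedBall (0 : EuclideanSpace ℝ (Fin 2)) 2))) := by rw [hK₁]
  have hfin2 : (a₂ - K₃) * (∫ s in Ioc 0 N, zetaCut N s) ≤ (a₂ - K₃) * (N - 3) :=
    mul_le_mul_of_nonpos_left hIζ (by linarith only [hK₃ge, hb1, mul_nonneg hc0 hsqN0])
  have hfin3 : (a₂ - K₃) * (N - 3) ≤ -(b + c * Real.sqrt N) * (N - 3) :=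
    mul_le_mul_of_nonneg_right (by linarith only [hK₃ge]) (by linarith only [hN4])
  have hbN : b * (N - 3) = (32 * smoothTransitionC2Bound * (Cf + M) *
      volume.real (closedBall (0 : EuclideanSpace ℝ (Fin 2)) 1) + 1) * (N - 3) := by rw [hb]
  have hfin4 : 8 * smoothTransitionC2Bound * (Cf + M) *
      volume.real (closedBall (0 : EuclideanSpace ℝ (Fin 2)) 1) * N ≤
      32 * smoothTransitionC2Bound * (Cf + M) *
        volume.real (closedBall (0 : EuclideanSpace ℝ (Fin 2)) 1) * (N - 3) := by
    have hP0 : 0 ≤ smoothTransitionC2Bound * (Cf + M) *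
        volume.real (closedBall (0 : EuclideanSpace ℝ (Fin 2)) 1) := by positivity
    linarith only [mul_nonneg hP0 (show (0 : ℝ) ≤ 24 * N - 96 by linarith only [hN4])]
  -- the source term is absorbed by `c √N (N − 3) ≥ (c √N / 4) N` (`N ≥ 4`)
  have hfin5 : c * Real.sqrt N / 4 * N ≤ c * Real.sqrt N * (N - 3) := by
    have h0 : 0 ≤ c * Real.sqrt N := mul_nonneg hc0 hsqN0
    nlinarith only [h0, hN4]
  -- `0 ≤ ∫A₁ + ∫(A₂ + A₃ + A₄) ≤ ε D − 1 ≤ −1/2`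
  have key : (0 : ℝ) ≤ 8 * smoothTransitionC2Bound * N * ε *
      volume.real (closedBall (0 : EuclideanSpace ℝ (Fin 2)) 2) + N * (ε * K₄) - 1 := by
    nlinarith only [hsum, hA1, hR1, hfin1, hCK₁, hA234, hR2, hE, hfin2, hfin3, hbN, hfin4, hfin5, hN4, hC,
      hCf0, hM.le, hv₁]
  have hεD' : ε * D = 8 * smoothTransitionC2Bound * N * ε *
      volume.real (closedBall (0 : EuclideanSpace ℝ (Fin 2)) 2) + N * (ε * K₄) := by
    rw [hD]; ring
  linarith only [hεD, hεD', key]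

/-- For a swirl subsolution pair with a NON-NEGATIVE scalar (as for the disc circulation of a closed-hemisphere profile) the
scalar vanishes identically. -/
theorem eq_zero_of_nonneg (hP : IsSubSwirl Cf Cu Cg A 0 f u) (hnn : ∀ t < 0, ∀ x, 0 ≤ f t x) :
    ∀ t < 0, ∀ x, f t x = 0 :=
  fun t ht x => le_antisymm (nonpos hP t ht x) (hnn t ht x)

end IsSubSwirl

end Summit.NavierStokesRegularity.NavierStokesRegularity.Theorems.HalfSpaceWindowDoorCirculationCarryingRigiditySubSwirlLiouville

end
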